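import Literature.Barriers.ValiantsHypothesis.KroneckerPositivityHardnessProofs
import HarnessLib

/-!
# The unary codes of the Kronecker instance of a 2D-X-RAY instance, in closed form

Preparation for the polynomial-time machine of `xrayToKronecker`
(`KroneckerPositivityHardnessProofs.lean`: the simplex embedding `2D-X-RAY → KRONECKER` of
Brunetti–Del Lungo–Gérard 2001 / Fischer–Ikenmeyer 2020, Thm. 5, whose running time is the named
fact `FischerIkenmeyer2020_xrayToKronecker_mem_FP`). The map writes the unary codes
`encodePartition λ ++ encodePartition μ ++ encodePartition π` of the three partitions with column
lengths `X = X(P_r) + μ'`, `Y = Y(P_r) + ν'`, `Z = Z(P_r) + ρ'` (`xrayLam`, `xrayMu`, `xrayPi`,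
`KroneckerXRayEmbedding.lean`). A machine emits these codes digit by digit, so this file makes
them explicit:

* the marginals of the discrete simplex `P_r = {x + y + z < r}` in closed form,
  `2 X_i(P_r) = (r - i)(r - i + 1)` (`two_mul_xMarginal_simplex`, likewise `Y`, `Z`): the
  `i`-th slice is a triangle of `(r-i)(r-i+1)/2` lattice points;
* the sorted parts of the transpose of a partition with prescribed weakly decreasing rows
  `X 0 ≥ X 1 ≥ ⋯` (`partitionOfRows`): `[c_0, …, c_{X(0)-1}]` with `c_j = #{i < L : j < X i}`
  (`rowCounts`, `sortedParts_transpose_partitionOfRows`) — the column lengths of the Young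
  diagram with rows `X`;
* hence, for an admissible instance, **`encodePartition (xrayLam r μ') = unaryList (rowCounts
  (liftX r μ') (r + 1))`** and likewise for `xrayMu`, `xrayPi` (`encodePartition_xrayLam`, …).

## References

* [FischerIkenmeyer2020] N. Fischer, C. Ikenmeyer, Comput. Complexity 29 (2020) 8, Thm. 5 (the
  embedding), §3 (unary encodings).
* [BrunettiDelLungoGerard2001] S. Brunetti, A. Del Lungo, Y. Gérard, Linear Algebra Appl. 339
  (2001) 59–73, Thm. 3.1 (proof: "a polynomial-time transformation").
* [IkenmeyerMulmuleyWalter2017] C. Ikenmeyer, K. D. Mulmuley, M. Walter, Comput. Complexity 26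
  (2017), §1.1 (KRONECKER, partitions in unary), Thm. 3.4.
* W. Fulton, *Young Tableaux*, CUP 1997, §0 (rows, columns, conjugate partition).
-/

namespace Literature.Barriers.ValiantsHypothesis

open Finset Literature.Combinatorics.Enumerative.Tomography Literature.NumberTheory.DiophantineGeometry
  Literature.Computability.Complexity

/-! ### The marginals of the discrete simplex in closed form -/

/-- The lattice points of the triangle `{(y, z) : y + z < k}`. [folklore] -/
def trianglePairs (k : ℕ) : Finset (ℕ × ℕ) := (range k ×ˢ range k).filter fun q => q.1 + q.2 < k

/-- Membership in the triangle. [folklore] -/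
theorem mem_trianglePairs {k : ℕ} {q : ℕ × ℕ} : q ∈ trianglePairs k ↔ q.1 + q.2 < k := by
  simp only [trianglePairs, mem_filter, mem_product, mem_range]
  constructor
  · exact fun h => h.2
  · intro h; exact ⟨⟨by omega, by omega⟩, h⟩

/-- **The triangle has `k(k+1)/2` points**: `2 #{y + z < k} = k (k + 1)`. [folklore] -/
theorem two_mul_card_trianglePairs (k : ℕ) : 2 * (trianglePairs k).card = k * (k + 1) := by
  have hfib : (trianglePairs k).card = ∑ y ∈ range k, (k - y) := by
    rw [card_eq_sum_card_fiberwise (f := Prod.fst) (t := range k)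
      (fun q hq => mem_range.2 (by have := mem_trianglePairs.1 hq; omega))]
    apply sum_congr rfl
    intro y hy
    rw [mem_range] at hy
    have : (trianglePairs k).filter (fun q => q.1 = y) = (range (k - y)).image fun z => (y, z) := by
      ext q
      simp only [mem_filter, mem_trianglePairs, mem_image, mem_range]
      constructor
      · rintro ⟨h1, rfl⟩
        exact ⟨q.2, by omega, rfl⟩
      · rintro ⟨z, hz, rfl⟩
        exact ⟨by simp; omega, rfl⟩
    rw [this, card_image_of_injective _ (fun a b h => by simpa using h), card_range]
  have hrefl : ∑ y ∈ range k, (k - y) = ∑ j ∈ range k, (j + 1) := by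
    rw [← sum_range_reflect (fun j => j + 1) k]
    apply sum_congr rfl
    intro y hy; rw [mem_range] at hy; omega
  have hs : ∑ j ∈ range k, (j + 1) = ∑ i ∈ range (k + 1), i := by
    rw [Finset.sum_range_succ']; simp
  rw [hfib, hrefl, hs, Nat.mul_comm 2, sum_range_id_mul_two, Nat.add_sub_cancel, Nat.mul_comm]

/-- **The `x`-marginal of the simplex**: `2 X_i(P_r) = (r - i)(r - i + 1)` (zero from `i = r`
on). [cite: FischerIkenmeyer2020, Theorem 5 (X(Q_{r-1}))] -/
theorem two_mul_xMarginal_simplex (r i : ℕ) : 2 * xMarginal (simplex r) i = (r - i) * (r - i + 1) := by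
  have : (simplex r).filter (fun p => p.1 = i) = (trianglePairs (r - i)).image fun q => (i, q.1, q.2) := by
    ext p
    simp only [mem_filter, mem_simplex, csum, mem_image, mem_trianglePairs]
    constructor
    · rintro ⟨h1, rfl⟩
      exact ⟨(p.2.1, p.2.2), by omega, rfl⟩
    · rintro ⟨q, hq, rfl⟩
      exact ⟨by simp only; omega, rfl⟩
  rw [xMarginal_def, this, card_image_of_injective _ (fun a b h => by simpa [Prod.ext_iff] using h),
    two_mul_card_trianglePairs]

/-- **The `y`-marginal of the simplex**: `2 Y_j(P_r) = (r - j)(r - j + 1)`. [cite: FischerIkenmeyer2020, Theorem 5] -/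
theorem two_mul_yMarginal_simplex (r j : ℕ) : 2 * yMarginal (simplex r) j = (r - j) * (r - j + 1) := by
  have : (simplex r).filter (fun p => p.2.1 = j) = (trianglePairs (r - j)).image fun q => (q.1, j, q.2) := by
    ext p
    simp only [mem_filter, mem_simplex, csum, mem_image, mem_trianglePairs]
    constructor
    · rintro ⟨h1, rfl⟩
      exact ⟨(p.1, p.2.2), by omega, rfl⟩
    · rintro ⟨q, hq, rfl⟩
      exact ⟨by simp only; omega, rfl⟩
  rw [yMarginal_def, this, card_image_of_injective _ (fun a b h => by simpa [Prod.ext_iff] using h),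
    two_mul_card_trianglePairs]

/-- **The `z`-marginal of the simplex**: `2 Z_k(P_r) = (r - k)(r - k + 1)`. [cite: FischerIkenmeyer2020, Theorem 5] -/
theorem two_mul_zMarginal_simplex (r k : ℕ) : 2 * zMarginal (simplex r) k = (r - k) * (r - k + 1) := by
  have : (simplex r).filter (fun p => p.2.2 = k) = (trianglePairs (r - k)).image fun q => (q.1, q.2, k) := by
    ext p
    simp only [mem_filter, mem_simplex, csum, mem_image, mem_trianglePairs]
    constructor
    · rintro ⟨h1, rfl⟩
      exact ⟨(p.1, p.2.1), by omega, rfl⟩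
    · rintro ⟨q, hq, rfl⟩
      exact ⟨by simp only; omega, rfl⟩
  rw [zMarginal_def, this, card_image_of_injective _ (fun a b h => by simpa [Prod.ext_iff] using h),
    two_mul_card_trianglePairs]

/-- The triangular number `k(k+1)/2`. [folklore] -/
def tri (k : ℕ) : ℕ := k * (k + 1) / 2

/-- `X_i(P_r) = tri (r - i)`. [folklore] -/
theorem xMarginal_simplex_eq_tri (r i : ℕ) : xMarginal (simplex r) i = tri (r - i) := by
  rw [tri, ← two_mul_xMarginal_simplex, Nat.mul_div_cancel_left _ Nat.two_pos]

/-- `Y_j(P_r) = tri (r - j)`. [folklore] -/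
theorem yMarginal_simplex_eq_tri (r j : ℕ) : yMarginal (simplex r) j = tri (r - j) := by
  rw [tri, ← two_mul_yMarginal_simplex, Nat.mul_div_cancel_left _ Nat.two_pos]

/-- `Z_k(P_r) = tri (r - k)`. [folklore] -/
theorem zMarginal_simplex_eq_tri (r k : ℕ) : zMarginal (simplex r) k = tri (r - k) := by
  rw [tri, ← two_mul_zMarginal_simplex, Nat.mul_div_cancel_left _ Nat.two_pos]

/-! ### The parts of the transpose of a partition with prescribed rows -/

/-- The column lengths of a Young diagram with rows `X 0 ≥ X 1 ≥ ⋯` (rows indexed `< L`):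
`c_j = #{i < L : j < X i}` for `j < X 0`. [folklore] -/
def rowCounts (X : ℕ → ℕ) (L : ℕ) : List ℕ :=
  (List.range (X 0)).map fun j => ((range L).filter fun i => j < X i).card

/-- Length of `rowCounts`. [folklore] -/
@[simp] theorem length_rowCounts (X : ℕ → ℕ) (L : ℕ) : (rowCounts X L).length = X 0 := by
  simp [rowCounts]

/-- **The sorted parts of the transpose of `partitionOfRows X L D`** for weakly decreasing `X`
with row sum `D` and `0 < L`: the list `rowCounts X L` (Fulton §0: the conjugate partition's
parts are the column lengths). [folklore] -/
theorem sortedParts_transpose_partitionOfRows {X : ℕ → ℕ} (hX : Antitone X) {L D : ℕ} (hL : 0 < L)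
    (h : ∑ i ∈ range L, X i = D) :
    (partitionOfRows X L D).transpose.sortedParts = rowCounts X L := by
  set P := partitionOfRows X L D with hP
  have hrow : ∀ i, P.youngDiagram.rowLen i = if i < L then X i else 0 := fun i => by
    rw [rowLen_youngDiagram, hP, getD_sortedParts_partitionOfRows hX h]
  have hcol0 : P.youngDiagram.colLen 0 ≤ L := by
    rw [← YoungDiagram.length_rowLens, Nat.Partition.rowLens_youngDiagram, Nat.Partition.length_sortedParts]
    exact card_parts_partitionOfRows_le hX h
  rw [Nat.Partition.sortedParts_transpose, YoungDiagram.rowLens, YoungDiagram.colLen_transpose, hrow 0, if_pos hL,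
    rowCounts]
  apply List.map_congr_left
  intro j _
  rw [YoungDiagram.rowLen_transpose,
    YoungDiagram.colLen_eq_card_filter _ j (L := L) ((P.youngDiagram.colLen_anti 0 j (Nat.zero_le j)).trans hcol0)]
  congr 1
  apply filter_congr
  intro i hi
  rw [mem_range] at hi
  rw [hrow i, if_pos hi]

/-! ### The three codes of the Kronecker instance -/

variable {r : ℕ} {μ' ν' ρ' : List ℕ}

/-- **The code of `λ`**: `encodePartition (xrayLam r μ') = unaryList (rowCounts X (r+1))`,
`X = X(P_r) + μ'`. [cite: FischerIkenmeyer2020, Theorem 5] -/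
theorem encodePartition_xrayLam (h : XRayAdmissible r μ' ν' ρ') :
    encodePartition (xrayLam r μ') = unaryList (rowCounts (liftX r μ') (r + 1)) := by
  rw [encodePartition, xrayLam, sortedParts_transpose_partitionOfRows h.antitoneX (Nat.succ_pos r)
    (sum_liftX h.length₁ le_rfl)]

/-- **The code of `μ`**: `encodePartition (xrayMu r μ' ν') = unaryList (rowCounts Y (r+1))`.
[cite: FischerIkenmeyer2020, Theorem 5] -/
theorem encodePartition_xrayMu (h : XRayAdmissible r μ' ν' ρ') :
    encodePartition (xrayMu r μ' ν') = unaryList (rowCounts (liftY r ν') (r + 1)) := by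
  rw [encodePartition, xrayMu, sortedParts_transpose_partitionOfRows h.antitoneY (Nat.succ_pos r) (sum_liftY h le_rfl)]

/-- **The code of `π`**: `encodePartition (xrayPi r μ' ρ') = unaryList (rowCounts Z (r+1))`.
[cite: FischerIkenmeyer2020, Theorem 5] -/
theorem encodePartition_xrayPi (h : XRayAdmissible r μ' ν' ρ') :
    encodePartition (xrayPi r μ' ρ') = unaryList (rowCounts (liftZ r ρ') (r + 1)) := by
  rw [encodePartition, xrayPi, sortedParts_transpose_partitionOfRows h.antitoneZ (Nat.succ_pos r) (sum_liftZ h le_rfl)]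

/-- The lifted `x`-marginal in closed form: `X_i = tri (r - i) + μ'_i`. [cite: FischerIkenmeyer2020, Theorem 5] -/
theorem liftX_eq (r : ℕ) (μ' : List ℕ) (i : ℕ) : liftX r μ' i = tri (r - i) + μ'.getD i 0 := by
  rw [liftX, xMarginal_simplex_eq_tri]

/-- `Y_j = tri (r - j) + ν'_j`. [cite: FischerIkenmeyer2020, Theorem 5] -/
theorem liftY_eq (r : ℕ) (ν' : List ℕ) (j : ℕ) : liftY r ν' j = tri (r - j) + ν'.getD j 0 := by
  rw [liftY, yMarginal_simplex_eq_tri]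

/-- `Z_k = tri (r - k) + ρ'_k`. [cite: FischerIkenmeyer2020, Theorem 5] -/
theorem liftZ_eq (r : ℕ) (ρ' : List ℕ) (k : ℕ) : liftZ r ρ' k = tri (r - k) + ρ'.getD k 0 := by
  rw [liftZ, zMarginal_simplex_eq_tri]

/-! ### Admissibility as a finite test -/

/-- Antitonicity of a function vanishing from `r + 1` on is a finite test of adjacent values.
[folklore] -/
theorem antitone_iff_forall_succ_le {f : ℕ → ℕ} {r : ℕ} (hf : ∀ i, r + 1 ≤ i → f i = 0) :
    Antitone f ↔ ∀ i ≤ r, f (i + 1) ≤ f i := by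
  constructor
  · intro h i _; exact h (Nat.le_succ i)
  · intro h
    apply antitone_nat_of_succ_le
    intro i
    by_cases hi : i ≤ r
    · exact h i hi
    · rw [hf (i + 1) (by omega)]; exact Nat.zero_le _

end Literature.Barriers.ValiantsHypothesis
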